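import Mathlib
import Summits.Ventures.PercRepro2.TypedSplit
import Summits.Ventures.PercRepro2.TypedPendant
import Summits.Ventures.PercRepro2.SepSplitRule

/-!
# Gluing at a general separator, X: the pendant-edge gadget — a far side of ONE typed edge, and
its chain-single orbit sum as twice the typed count of the whole graph (blind cell PercRepro2,
mine-2 g49, 2026-08-29; `conjectures/MINE-2.md` M2-100; g48's successor item (ii))

Under a split the inert factor of `typedCount_eq_sepSplit` is `1` (every typed edge lies in a
side: `sdiff_sides_eq_empty_of_sepSplit`, `typedCount_eq_sum_far_root`).  When the far side holds
exactly ONE typed edge `e` (`sideF ends VL F = {e}`), the three copies realise the far data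
`pendData a` (the far side with `e` set to `a`) and the far count of a data triple counts the
colourings of `e` producing it (`farCount_single`, by `typedCount_split`); for `τ e = 2` the
identity reads `N = Σ_{(a,b,c) ∈ {(0,1,1),(1,0,1),(1,1,0)}} rootCount(q_a, q_b, q_c)`
(`typedCount_eq_three_root_two`; `τ e = 1` mirror), and the `S₃`-orbit sum of the single realised
chain-single triple is TWICE that: **`orbitRootS_pendant_two`: orbitRootS (q₀, q₁, q₁) = 2 · N`**
(`orbitRootS_pendant_one` for type `1`).  Hence the sign of a single-edge-bundle chain orbit sum on
a root side IS row 2′TRI on the root side plus the pendant typed edge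
(`typedCount_nonneg_iff_orbitRootS_pendant_two`), and with the far mark `o` or `b` a leaf, the
night-3 leaf rules move the mark onto the separator vertex: the orbit sum is
`2 · C(2, τ e − 1) · N(τ[e := 3])` (`orbitRootS_pendant_two_of_leaf_o / _b`).  Own work; standard
axioms.
-/

namespace Summit.Ventures.PercRepro2

open UnionCluster

namespace CovForm

namespace RootBridge

open OneTyped TypedA3 Untouched TypedFactor Separated TypedRed

/-! ## The inert factor of a split is one -/

section Inert

open Classical

variable {V : Type*} {E : Type*} {ι : Type*} [Fintype E] [DecidableEq E] {R : Type*} [Field R]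
variable (ends : E → Sym2 V) (mk : Fin 5 → V) (σ : ι → V)

omit [Fintype E] in
/-- Under a split every typed edge lies in a side. -/
lemma sdiff_sides_eq_empty_of_sepSplit {side : Fin 5 → Bool} {VL VH : Set V} {F : Finset E}
    {z : Config E} (h : SepSplit ends mk σ side VL VH F z) :
    F \ (sideF ends VL F ∪ sideF ends VH F) = ∅ := by
  refine Finset.eq_empty_of_forall_notMem fun e he => ?_
  rw [Finset.mem_sdiff, Finset.mem_union] at he
  obtain ⟨heF, hn⟩ := he
  have hz : zF F z e = true := by simp [zF, heF]
  rcases h.split e hz with hL | hH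
  · exact hn (Or.inl (Finset.mem_filter.mpr ⟨heF, hL⟩))
  · exact hn (Or.inr (Finset.mem_filter.mpr ⟨heF, hH⟩))

/-- **The typed identity at a split without the inert factor**:
`typedCount F z τ K₃ = Σ_p farCount(p) · rootCount(p)`. -/
theorem typedCount_eq_sum_far_root [Fintype ι] [DecidableEq ι] {side : Fin 5 → Bool}
    {VL VH : Set V} (F : Finset E) (z : Config E) (τ : E → ℕ)
    (h : SepSplit ends mk σ side VL VH F z) :
    typedCount F z τ
        (K3 ends (mk 0) (mk 1) (mk 2) (mk 3) (mk 4) : Config E → Config E → Config E → R) =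
      ∑ p : Pat3S ι, typedCount (sideF ends VL F) z τ (farKS ends mk σ VL p) *
        typedCount (sideF ends VH F) z τ (rootKS ends mk σ side VH p) := by
  rw [typedCount_eq_sepSplit ends mk σ F z τ h, sdiff_sides_eq_empty_of_sepSplit ends mk σ h,
    typedCount_empty, mul_one]

end Inert

/-! ## A far side of one typed edge -/

section Pendant

open Classical

variable {V : Type*} {E : Type*} {ι : Type*} [Fintype E] [DecidableEq E] {R : Type*} [Field R]
variable (ends : E → Sym2 V) (mk : Fin 5 → V) (σ : ι → V)

/-- The far datum of the far side with the edge `e` set to `a`. -/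
noncomputable def pendData (VL : Set V) (e : E) (z : Config E) (a : Bool) : SideData ι :=
  sideData ends mk σ (withinRestr ends VL (Function.update z e a))

omit [Fintype E] [DecidableEq E] in
/-- Summing a function against the exact indicators of a data triple picks the triple
(the `R`-valued form). -/
lemma sum_exactS_R [Fintype ι] [DecidableEq ι] (f : Pat3S ι → R) (q : Pat3S ι) :
    (∑ p : Pat3S ι, ((exactS p.1 q.1 * exactS p.2.1 q.2.1 * exactS p.2.2 q.2.2 : ℤ) : R) * f p) =
      f q := by
  rw [Finset.sum_eq_single q]
  · simp [exactS]
  · intro p _ hpq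
    by_cases h1 : p.1 = q.1
    · by_cases h2 : p.2.1 = q.2.1
      · by_cases h3 : p.2.2 = q.2.2
        · exact absurd (Prod.ext h1 (Prod.ext h2 h3)) hpq
        · simp [exactS, h3]
      · simp [exactS, h2]
    · simp [exactS, h1]
  · intro h
    exact absurd (Finset.mem_univ q) h

/-- **The far count of a one-edge far side** counts the colourings of the edge producing the
data triple. -/
lemma farCount_single (VL : Set V) {F : Finset E} {e : E} (hA : sideF ends VL F = {e})
    (z : Config E) (τ : E → ℕ) (p : Pat3S ι) :
    typedCount (sideF ends VL F) z τ (farKS ends mk σ VL p : Config E → Config E → Config E → R) =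
      ∑ a : Bool, ∑ b : Bool, ∑ c : Bool,
        if a.toNat + b.toNat + c.toNat = τ e then
          ((exactS p.1 (pendData ends mk σ VL e z a) * exactS p.2.1 (pendData ends mk σ VL e z b) *
            exactS p.2.2 (pendData ends mk σ VL e z c) : ℤ) : R)
        else 0 := by
  rw [hA, typedCount_split {e} e (Finset.mem_singleton_self e) z τ]
  simp only [Finset.erase_singleton, typedCount_empty, Function.update_idem]
  rfl

/-- The far count for type `2`: the three placements of the closed copy. -/
lemma farCount_single_two (VL : Set V) {F : Finset E} {e : E} (hA : sideF ends VL F = {e})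
    (z : Config E) (τ : E → ℕ) (hτ : τ e = 2) (p : Pat3S ι) :
    typedCount (sideF ends VL F) z τ (farKS ends mk σ VL p : Config E → Config E → Config E → R) =
      ((exactS p.1 (pendData ends mk σ VL e z false) * exactS p.2.1 (pendData ends mk σ VL e z true) *
          exactS p.2.2 (pendData ends mk σ VL e z true) : ℤ) : R) +
        ((exactS p.1 (pendData ends mk σ VL e z true) * exactS p.2.1 (pendData ends mk σ VL e z false) *
          exactS p.2.2 (pendData ends mk σ VL e z true) : ℤ) : R) +
        ((exactS p.1 (pendData ends mk σ VL e z true) * exactS p.2.1 (pendData ends mk σ VL e z true) *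
          exactS p.2.2 (pendData ends mk σ VL e z false) : ℤ) : R) := by
  rw [farCount_single ends mk σ VL hA z τ p]
  simp only [Fintype.sum_bool, Bool.toNat_true, Bool.toNat_false, hτ]
  norm_num
  ring

/-- The far count for type `1`: the three placements of the open copy. -/
lemma farCount_single_one (VL : Set V) {F : Finset E} {e : E} (hA : sideF ends VL F = {e})
    (z : Config E) (τ : E → ℕ) (hτ : τ e = 1) (p : Pat3S ι) :
    typedCount (sideF ends VL F) z τ (farKS ends mk σ VL p : Config E → Config E → Config E → R) =
      ((exactS p.1 (pendData ends mk σ VL e z true) * exactS p.2.1 (pendData ends mk σ VL e z false) *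
          exactS p.2.2 (pendData ends mk σ VL e z false) : ℤ) : R) +
        ((exactS p.1 (pendData ends mk σ VL e z false) * exactS p.2.1 (pendData ends mk σ VL e z true) *
          exactS p.2.2 (pendData ends mk σ VL e z false) : ℤ) : R) +
        ((exactS p.1 (pendData ends mk σ VL e z false) * exactS p.2.1 (pendData ends mk σ VL e z false) *
          exactS p.2.2 (pendData ends mk σ VL e z true) : ℤ) : R) := by
  rw [farCount_single ends mk σ VL hA z τ p]
  simp only [Fintype.sum_bool, Bool.toNat_true, Bool.toNat_false, hτ]
  norm_num
  ring

/-- **The typed count with a one-edge far side of type `2`** is the sum of the three glued root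
counts with the closed copy in each place. -/
theorem typedCount_eq_three_root_two [Fintype ι] [DecidableEq ι] {side : Fin 5 → Bool}
    {VL VH : Set V} {F : Finset E} {e : E} (hA : sideF ends VL F = {e}) (z : Config E)
    (τ : E → ℕ) (hτ : τ e = 2) (h : SepSplit ends mk σ side VL VH F z) :
    typedCount F z τ
        (K3 ends (mk 0) (mk 1) (mk 2) (mk 3) (mk 4) : Config E → Config E → Config E → R) =
      typedCount (sideF ends VH F) z τ (rootKS ends mk σ side VH
          (pendData ends mk σ VL e z false, pendData ends mk σ VL e z true,
            pendData ends mk σ VL e z true)) +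
        typedCount (sideF ends VH F) z τ (rootKS ends mk σ side VH
          (pendData ends mk σ VL e z true, pendData ends mk σ VL e z false,
            pendData ends mk σ VL e z true)) +
        typedCount (sideF ends VH F) z τ (rootKS ends mk σ side VH
          (pendData ends mk σ VL e z true, pendData ends mk σ VL e z true,
            pendData ends mk σ VL e z false)) := by
  rw [typedCount_eq_sum_far_root ends mk σ F z τ h]
  simp only [farCount_single_two ends mk σ VL hA z τ hτ, add_mul, Finset.sum_add_distrib]
  rw [sum_exactS_R (fun p => typedCount (sideF ends VH F) z τ (rootKS ends mk σ side VH p))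
      (pendData ends mk σ VL e z false, pendData ends mk σ VL e z true,
        pendData ends mk σ VL e z true),
    sum_exactS_R (fun p => typedCount (sideF ends VH F) z τ (rootKS ends mk σ side VH p))
      (pendData ends mk σ VL e z true, pendData ends mk σ VL e z false,
        pendData ends mk σ VL e z true),
    sum_exactS_R (fun p => typedCount (sideF ends VH F) z τ (rootKS ends mk σ side VH p))
      (pendData ends mk σ VL e z true, pendData ends mk σ VL e z true,
        pendData ends mk σ VL e z false)]

/-- **The typed count with a one-edge far side of type `1`** is the sum of the three glued root
counts with the open copy in each place. -/
theorem typedCount_eq_three_root_one [Fintype ι] [DecidableEq ι] {side : Fin 5 → Bool}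
    {VL VH : Set V} {F : Finset E} {e : E} (hA : sideF ends VL F = {e}) (z : Config E)
    (τ : E → ℕ) (hτ : τ e = 1) (h : SepSplit ends mk σ side VL VH F z) :
    typedCount F z τ
        (K3 ends (mk 0) (mk 1) (mk 2) (mk 3) (mk 4) : Config E → Config E → Config E → R) =
      typedCount (sideF ends VH F) z τ (rootKS ends mk σ side VH
          (pendData ends mk σ VL e z true, pendData ends mk σ VL e z false,
            pendData ends mk σ VL e z false)) +
        typedCount (sideF ends VH F) z τ (rootKS ends mk σ side VH
          (pendData ends mk σ VL e z false, pendData ends mk σ VL e z true,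
            pendData ends mk σ VL e z false)) +
        typedCount (sideF ends VH F) z τ (rootKS ends mk σ side VH
          (pendData ends mk σ VL e z false, pendData ends mk σ VL e z false,
            pendData ends mk σ VL e z true)) := by
  rw [typedCount_eq_sum_far_root ends mk σ F z τ h]
  simp only [farCount_single_one ends mk σ VL hA z τ hτ, add_mul, Finset.sum_add_distrib]
  rw [sum_exactS_R (fun p => typedCount (sideF ends VH F) z τ (rootKS ends mk σ side VH p))
      (pendData ends mk σ VL e z true, pendData ends mk σ VL e z false,
        pendData ends mk σ VL e z false),
    sum_exactS_R (fun p => typedCount (sideF ends VH F) z τ (rootKS ends mk σ side VH p))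
      (pendData ends mk σ VL e z false, pendData ends mk σ VL e z true,
        pendData ends mk σ VL e z false),
    sum_exactS_R (fun p => typedCount (sideF ends VH F) z τ (rootKS ends mk σ side VH p))
      (pendData ends mk σ VL e z false, pendData ends mk σ VL e z false,
        pendData ends mk σ VL e z true)]

/-- **THE PENDANT-EDGE GADGET, type `2`**: the `S₃`-orbit sum of the glued root counts of the
far triple `(q₀, q₁, q₁)` of a one-edge far side is TWICE the typed count of the whole graph. -/
theorem orbitRootS_pendant_two [Fintype ι] [DecidableEq ι] {side : Fin 5 → Bool} {VL VH : Set V}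
    {F : Finset E} {e : E} (hA : sideF ends VL F = {e}) (z : Config E) (τ : E → ℕ) (hτ : τ e = 2)
    (h : SepSplit ends mk σ side VL VH F z) :
    orbitRootS ends mk σ side VH (sideF ends VH F) z τ
        (pendData ends mk σ VL e z false, pendData ends mk σ VL e z true,
          pendData ends mk σ VL e z true) =
      2 * typedCount F z τ
        (K3 ends (mk 0) (mk 1) (mk 2) (mk 3) (mk 4) : Config E → Config E → Config E → R) := by
  rw [typedCount_eq_three_root_two ends mk σ hA z τ hτ h]
  unfold orbitRootS orbitSumG
  dsimp only
  ring

/-- **THE PENDANT-EDGE GADGET, type `1`**: the orbit sum of `(q₁, q₀, q₀)` is twice the typed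
count of the whole graph. -/
theorem orbitRootS_pendant_one [Fintype ι] [DecidableEq ι] {side : Fin 5 → Bool} {VL VH : Set V}
    {F : Finset E} {e : E} (hA : sideF ends VL F = {e}) (z : Config E) (τ : E → ℕ) (hτ : τ e = 1)
    (h : SepSplit ends mk σ side VL VH F z) :
    orbitRootS ends mk σ side VH (sideF ends VH F) z τ
        (pendData ends mk σ VL e z true, pendData ends mk σ VL e z false,
          pendData ends mk σ VL e z false) =
      2 * typedCount F z τ
        (K3 ends (mk 0) (mk 1) (mk 2) (mk 3) (mk 4) : Config E → Config E → Config E → R) := by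
  rw [typedCount_eq_three_root_one ends mk σ hA z τ hτ h]
  unfold orbitRootS orbitSumG
  dsimp only
  ring

end Pendant

/-! ## The sign, and the leaf rules -/

section Sign

open Classical

variable {V : Type*} {E : Type*} {ι : Type*} [Fintype E] [DecidableEq E] [Fintype ι]
  [DecidableEq ι] {R : Type*} [Field R] [LinearOrder R] [IsStrictOrderedRing R]
variable (ends : E → Sym2 V) (mk : Fin 5 → V) (σ : ι → V)

/-- **Row 2′TRI on the graph with a pendant typed edge of type `2` IS the sign of the single-edge
chain-single orbit sum on the root side.** -/
theorem typedCount_nonneg_iff_orbitRootS_pendant_two {side : Fin 5 → Bool} {VL VH : Set V}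
    {F : Finset E} {e : E} (hA : sideF ends VL F = {e}) (z : Config E) (τ : E → ℕ) (hτ : τ e = 2)
    (h : SepSplit ends mk σ side VL VH F z) :
    (0 ≤ typedCount F z τ
        (K3 ends (mk 0) (mk 1) (mk 2) (mk 3) (mk 4) : Config E → Config E → Config E → R)) ↔
      (0 : R) ≤ orbitRootS ends mk σ side VH (sideF ends VH F) z τ
        (pendData ends mk σ VL e z false, pendData ends mk σ VL e z true,
          pendData ends mk σ VL e z true) := by
  rw [orbitRootS_pendant_two ends mk σ hA z τ hτ h]
  constructor
  · intro hN
    exact mul_nonneg (by norm_num : (0 : R) ≤ 2) hN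
  · intro hO
    exact (mul_nonneg_iff_of_pos_left (by norm_num : (0 : R) < 2)).mp hO

/-- **Row 2′TRI on the graph with a pendant typed edge of type `1` IS the sign of the single-edge
chain-single orbit sum on the root side.** -/
theorem typedCount_nonneg_iff_orbitRootS_pendant_one {side : Fin 5 → Bool} {VL VH : Set V}
    {F : Finset E} {e : E} (hA : sideF ends VL F = {e}) (z : Config E) (τ : E → ℕ) (hτ : τ e = 1)
    (h : SepSplit ends mk σ side VL VH F z) :
    (0 ≤ typedCount F z τ
        (K3 ends (mk 0) (mk 1) (mk 2) (mk 3) (mk 4) : Config E → Config E → Config E → R)) ↔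
      (0 : R) ≤ orbitRootS ends mk σ side VH (sideF ends VH F) z τ
        (pendData ends mk σ VL e z true, pendData ends mk σ VL e z false,
          pendData ends mk σ VL e z false) := by
  rw [orbitRootS_pendant_one ends mk σ hA z τ hτ h]
  constructor
  · intro hN
    exact mul_nonneg (by norm_num : (0 : R) ≤ 2) hN
  · intro hO
    exact (mul_nonneg_iff_of_pos_left (by norm_num : (0 : R) < 2)).mp hO

omit [LinearOrder R] [IsStrictOrderedRing R] in
/-- **The far mark `o` a leaf at the pendant edge** (type `2`): the orbit sum is
`2 · C(2, 1) · N(τ[e := 3])` — the mark moved onto the separator vertex. -/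
theorem orbitRootS_pendant_two_of_leaf_o {side : Fin 5 → Bool} {VL VH : Set V} {F : Finset E}
    {e : E} {u : V} (hf : ends e = s(mk 0, u)) (hleaf : ∀ f, mk 0 ∈ ends f → f = e)
    (hou : mk 0 ≠ u) (ho1 : mk 0 ≠ mk 1) (ho2 : mk 0 ≠ mk 2) (ho3 : mk 0 ≠ mk 3)
    (hob : mk 0 ≠ mk 4) (hA : sideF ends VL F = {e}) (heF : e ∈ F) (z : Config E) (τ : E → ℕ)
    (hτ : τ e = 2) (h : SepSplit ends mk σ side VL VH F z) :
    (orbitRootS ends mk σ side VH (sideF ends VH F) z τ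
        (pendData ends mk σ VL e z false, pendData ends mk σ VL e z true,
          pendData ends mk σ VL e z true) : R) =
      2 * ((Nat.choose 2 (τ e - 1) : R) * typedCount F z (Function.update τ e 3)
        (K3 ends (mk 0) (mk 1) (mk 2) (mk 3) (mk 4) : Config E → Config E → Config E → R)) := by
  rw [orbitRootS_pendant_two ends mk σ hA z τ hτ h,
    typedCount_pendant_o ends (mk 0) (mk 1) (mk 2) (mk 3) (mk 4) hf hleaf hou ho1 ho2 ho3 hob F
      heF z τ (by omega)]

omit [LinearOrder R] [IsStrictOrderedRing R] in
/-- **The far mark `b` a leaf at the pendant edge** (type `2`): the orbit sum is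
`2 · C(2, 1) · N(τ[e := 3])`. -/
theorem orbitRootS_pendant_two_of_leaf_b {side : Fin 5 → Bool} {VL VH : Set V} {F : Finset E}
    {e : E} {u : V} (hf : ends e = s(mk 4, u)) (hleaf : ∀ f, mk 4 ∈ ends f → f = e)
    (hbu : mk 4 ≠ u) (hbo : mk 4 ≠ mk 0) (hb1 : mk 4 ≠ mk 1) (hb2 : mk 4 ≠ mk 2)
    (hb3 : mk 4 ≠ mk 3) (hA : sideF ends VL F = {e}) (heF : e ∈ F) (z : Config E) (τ : E → ℕ)
    (hτ : τ e = 2) (h : SepSplit ends mk σ side VL VH F z) :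
    (orbitRootS ends mk σ side VH (sideF ends VH F) z τ
        (pendData ends mk σ VL e z false, pendData ends mk σ VL e z true,
          pendData ends mk σ VL e z true) : R) =
      2 * ((Nat.choose 2 (τ e - 1) : R) * typedCount F z (Function.update τ e 3)
        (K3 ends (mk 0) (mk 1) (mk 2) (mk 3) (mk 4) : Config E → Config E → Config E → R)) := by
  rw [orbitRootS_pendant_two ends mk σ hA z τ hτ h,
    typedCount_pendant_b ends (mk 0) (mk 1) (mk 2) (mk 3) (mk 4) hf hleaf hbu hbo hb1 hb2 hb3 F
      heF z τ (by omega)]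

end Sign

end RootBridge

end CovForm

end Summit.Ventures.PercRepro2
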